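import Summits.ResolutionOfSingularities.ResolutionOfSingularities.Theorems.PurelyInseparableDim4JointForestRootWaiting
import Summits.ResolutionOfSingularities.ResolutionOfSingularities.Theorems.PurelyInseparableDim4JointWaitingToyComputations
import Mathlib.Algebra.CharP.Two
import HarnessLib

/-!
# Purely inseparable four-folds: the v3-lite TOY in CHARACTERISTIC 2 — a child under the waiting kid (brick S3 (c) «joint
# point∘coordinate chains», part 48 = instance inst₁₅; cell `res-dim4-pi`)

[OURS · counted 0] (D-0157 DOOR 2; desk WORD #66 (4)(c), #74 (g), #99 (d); frame `PIDim4.TerminationImpliesOrderReduction`, S3 (c)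
v3-lite, memo `S3c-V3-DESIGN.md` Addendum 2 («p = 2: one more blow-up in the y₃ chart»); host item stmt-ResolutionOfSingularities-16155,
helper). Nothing here proves resolution of singularities in dimension ≥ 4 / characteristic `p` — NOT here, not anywhere in this programme.

Part 39 certified the toy `F = x₁^p x₄ + x₁x₂^{p−1}(x₃^p − 1)` for `p ≥ 3`. At `p = 2` (`F = x₁² x₄ + x₁x₂(x₃² − 1)`) the waiting kid's
state `H = y₁² y₄ + y₁ y₃²` is NOT dead after blowing up `V(z, y₁, y₃)`: its `y₃`-chart reads `u₁² u₄ + u₁ u₃` (part 32a), whose pairs with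
`u₁ = 0` are all equimultiple (the degree-2 monomial `u₁u₃` survives) — a CHILD `(u₃, 0, {u₁, u₃})` of the waiting kid, state
`u₁² u₄ + u₁ u₃`, whose blow-up reads `v₄ + v₃` / `v₁² v₄ + v₁` — dead (the last one by `2 = 0`). So in characteristic 2 the toy is
host → waiting kid → child → dead, certified by part 38 with a NON-EMPTY plan below the waiting kid (as part 45):

* §1 the `p = 2` computations; §2 **`exists_isMarkedResolution_inst₁₅`** — `(𝔸⁵_K, (z² + x₁² x₄ + x₁x₂(x₃² − 1))·𝒪, [], 2)` admits a marked
  resolution (BGMW Def. 3.1.3). UNCONDITIONAL. With part 39 the toy is certified for EVERY prime `p`.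

AI-produced formalisation, weaker than expert review. bears_on: LADDER-RESOLUTION:D157-DOOR2 (res-dim4-pi · S3 (c) joint v3-lite · toy at
p = 2).
-/

set_option linter.dupNamespace false -- D-0017: single-problem summit path `Summit.<S>.<S>.…` by design

noncomputable section

open MvPolynomial Finset CategoryTheory AlgebraicGeometry Opposite TopologicalSpace

namespace Summit.ResolutionOfSingularities.ResolutionOfSingularities.Theorems.PIDim4

open Literature.AlgebraicGeometry.Resolution
open Literature.AlgebraicGeometry.Resolution.Hauser2010
open Literature.AlgebraicGeometry.Resolution.AffinePointBlowup (P A γ coord Wtop ξ)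

namespace Equimultiple

section InstanceTwo

variable {K : Type} [Field K]

/-! ## §1 Computations in characteristic 2 -/

section General

variable {p : ℕ} [hp : Fact p.Prime]

/-- **The `y₁`-chart of the waiting kid's blow-up is DEAD for every `p`**: the linear coefficient of `u₄` in `u₄ + u₁u₃^p` is `1`.
[cite: Hauser2010, §F (equiconstant points)] -/
theorem not_isEquimultiplePoint_T_zero_H_toy [DecidableEq K] (b : Fin 4 → K) (s : State K)
    (hs : s.F = X 0 ^ p * X 3 + X 0 * X 2 ^ p) : ¬ CentreBlowup.IsEquimultiplePoint p ({0, 2} : Finset (Fin 4)) 0 b s := by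
  intro h
  unfold CentreBlowup.IsEquimultiplePoint CentreBlowup.pointTransform at h
  rw [hs, chartTransform_T_zero_H_toy] at h
  have h3 := h (Finsupp.single 3 1) (Finsupp.single_ne_zero.mpr one_ne_zero) (by rw [Finsupp.degree_single]; exact hp.out.one_lt)
  rw [coeff_single_one_translate] at h3
  simp [(pderiv (3 : Fin 4)).leibniz_pow] at h3

end General

variable [CharP K 2]

omit [CharP K 2] in
/-- At `p = 2` the `y₃`-chart of the waiting kid's blow-up reads `u₁² u₄ + u₁ u₃`. [cite: HauserPerlega2019PRIMS, §2] -/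
theorem chartTransform_T_two_H_two :
    CentreBlowup.chartTransform 2 ({0, 2} : Finset (Fin 4)) 2 (X 0 ^ 2 * X 3 + X 0 * X 2 ^ 2 : MvPolynomial (Fin 4) K) =
      X 0 ^ 2 * X 3 + X 0 * X 2 := by
  rw [chartTransform_T_two_H_toy (p := 2)]
  ring

omit [CharP K 2] in
/-- `u₁² u₄ + u₁ u₃` as a sum of two monomials. [folklore] -/
theorem G_two_eq_monomial_add :
    (X 0 ^ 2 * X 3 + X 0 * X 2 : MvPolynomial (Fin 4) K) =
      monomial (Finsupp.single 0 2 + Finsupp.single 3 1) 1 + monomial (Finsupp.single 0 1 + Finsupp.single 2 1) 1 := by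
  rw [X_pow_mul_X_eq_monomial, X, X, monomial_mul, mul_one]

omit [CharP K 2] in
/-- **The equimultiple pairs of the `y₃`-chart have `b₁ = 0`** (the linear coefficient of `u₃` is `b₁`). [cite: Hauser2010, §F] -/
theorem eq_zero_of_isEquimultiplePoint_T_two_H_two [DecidableEq K] {b : Fin 4 → K} (s : State K)
    (hs : s.F = X 0 ^ 2 * X 3 + X 0 * X 2 ^ 2) (h : CentreBlowup.IsEquimultiplePoint 2 ({0, 2} : Finset (Fin 4)) 2 b s) :
    b 0 = 0 := by
  unfold CentreBlowup.IsEquimultiplePoint CentreBlowup.pointTransform at h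
  rw [hs, chartTransform_T_two_H_two] at h
  have h2 := eval_pderiv_eq_zero_of_forall_coeff (p := 2) b _ h 2
  simp [(pderiv (2 : Fin 4)).leibniz_pow] at h2
  exact h2

omit [CharP K 2] in
/-- **The pair `(u₃, 0)` is equimultiple at `p = 2`**: every monomial of `u₁² u₄ + u₁ u₃` has degree `≥ 2` — so the CHILD `(u₃, 0, {u₁, u₃})`
is a plan entry covering every pair of the chart. [cite: Hauser2010, §F (equiconstant points)] -/
theorem isEquimultiplePoint_T_two_zero_H_two [DecidableEq K] (s : State K) (hs : s.F = X 0 ^ 2 * X 3 + X 0 * X 2 ^ 2) :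
    CentreBlowup.IsEquimultiplePoint 2 ({0, 2} : Finset (Fin 4)) 2 (0 : Fin 4 → K) s := by
  unfold CentreBlowup.IsEquimultiplePoint CentreBlowup.pointTransform
  rw [hs, chartTransform_T_two_H_two, PointBlowup.translate_zero]
  intro d _ hdeg
  rw [G_two_eq_monomial_add, coeff_add, coeff_monomial, coeff_monomial, if_neg, if_neg, add_zero]
  · intro h; rw [← h, map_add, Finsupp.degree_single, Finsupp.degree_single] at hdeg; omega
  · intro h; rw [← h, map_add, Finsupp.degree_single, Finsupp.degree_single] at hdeg; omega

omit [CharP K 2] in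
/-- `u₁² u₄ + u₁ u₃` is clean at `p = 2`. [cite: HauserPerlega2019PRIMS, §2 (cleaning)] -/
theorem isClean_G_two :
    Literature.Barriers.ResolutionOfSingularities.HauserPerlega.IsClean 2 (X 0 ^ 2 * X 3 + X 0 * X 2 : MvPolynomial (Fin 4) K) := by
  intro d hd hpth
  rw [G_two_eq_monomial_add] at hd
  have key : ∀ i : Fin 4, d i = 1 → False := fun i hi => by
    have h := hpth i (by rw [Finsupp.mem_support_iff, hi]; exact one_ne_zero)
    rw [hi] at h
    exact absurd (Nat.dvd_one.mp h) (by norm_num)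
  rcases Finset.mem_union.mp (Finset.mem_of_subset MvPolynomial.support_add hd) with h | h <;>
    have := Finset.mem_singleton.mp (Finset.mem_of_subset support_monomial_subset h) <;> subst this
  · exact key 3 (by simp)
  · exact key 2 (by simp)

omit [CharP K 2] in
/-- **The child's state**: `(step 2 {u₁,u₃} u₃ 0 s₁).F = u₁² u₄ + u₁ u₃` when `s₁.F = H`. [cite: Hauser2010, §§F–G] -/
theorem step_T_two_H_two [DecidableEq K] (s : State K) (hs : s.F = X 0 ^ 2 * X 3 + X 0 * X 2 ^ 2) :
    (CentreBlowup.step 2 ({0, 2} : Finset (Fin 4)) 2 (0 : Fin 4 → K) s).F = X 0 ^ 2 * X 3 + X 0 * X 2 := by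
  show deletePthPowers 2 (PointBlowup.translate (0 : Fin 4 → K) (CentreBlowup.chartTransform 2 ({0, 2} : Finset (Fin 4)) 2 s.F)) = _
  rw [hs, chartTransform_T_two_H_two, PointBlowup.translate_zero]
  exact Literature.Barriers.ResolutionOfSingularities.HauserPerlega.deletePthPowers_eq_self isClean_G_two

omit [CharP K 2] in
/-- **`V(z, u₁, u₃)` is permissible for the child's state.** [cite: HauserPerlega2019PRIMS, §2 (condition (1))] -/
theorem isPermissibleCentre_G_two : IsPermissibleCentre 2 ({0, 2} : Finset (Fin 4)) (X 0 ^ 2 * X 3 + X 0 * X 2 : MvPolynomial (Fin 4) K) := by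
  refine ⟨⟨0, Finset.mem_insert_self _ _⟩, Finset.le_inf fun d hd => ?_⟩
  rw [G_two_eq_monomial_add] at hd
  rcases Finset.mem_union.mp (Finset.mem_of_subset MvPolynomial.support_add hd) with h | h <;>
    have := Finset.mem_singleton.mp (Finset.mem_of_subset support_monomial_subset h) <;> subst this <;> simp [degIn_pair₀₂]

omit [CharP K 2] in
/-- The child's charts: `u₁`-chart `v₄ + v₃`, `u₃`-chart `v₁² v₄ + v₁`. [cite: HauserPerlega2019PRIMS, §2] -/
theorem chartTransform_G_two (k : Fin 4) (hk : k ∈ ({0, 2} : Finset (Fin 4))) :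
    CentreBlowup.chartTransform 2 ({0, 2} : Finset (Fin 4)) k (X 0 ^ 2 * X 3 + X 0 * X 2 : MvPolynomial (Fin 4) K) =
      if k = 0 then X 3 + X 2 else X 0 ^ 2 * X 3 + X 0 := by
  rw [G_two_eq_monomial_add, CentreBlowup.chartTransform_monomial_add_monomial]
  simp only [CentreBlowup.chartExponent, degIn_pair₀₂]
  rcases Finset.mem_insert.mp hk with rfl | hk
  · have e1 : (Finsupp.single 0 2 + Finsupp.single 3 1 : Fin 4 →₀ ℕ).update 0
        ((Finsupp.single 0 2 + Finsupp.single 3 1 : Fin 4 →₀ ℕ) 0 + (Finsupp.single 0 2 + Finsupp.single 3 1 : Fin 4 →₀ ℕ) 2 - 2) =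
          Finsupp.single 3 1 := by
      ext i; fin_cases i <;> simp [Finsupp.update_apply]
    have e2 : (Finsupp.single 0 1 + Finsupp.single 2 1 : Fin 4 →₀ ℕ).update 0
        ((Finsupp.single 0 1 + Finsupp.single 2 1 : Fin 4 →₀ ℕ) 0 + (Finsupp.single 0 1 + Finsupp.single 2 1 : Fin 4 →₀ ℕ) 2 - 2) =
          Finsupp.single 2 1 := by
      ext i; fin_cases i <;> simp [Finsupp.update_apply]
    rw [e1, e2, if_pos rfl]
    rfl
  · have hk' : k = 2 := Finset.mem_singleton.mp hk
    subst hk'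
    have e1 : (Finsupp.single 0 2 + Finsupp.single 3 1 : Fin 4 →₀ ℕ).update 2
        ((Finsupp.single 0 2 + Finsupp.single 3 1 : Fin 4 →₀ ℕ) 0 + (Finsupp.single 0 2 + Finsupp.single 3 1 : Fin 4 →₀ ℕ) 2 - 2) =
          Finsupp.single 0 2 + Finsupp.single 3 1 := by
      ext i; fin_cases i <;> simp [Finsupp.update_apply]
    have e2 : (Finsupp.single 0 1 + Finsupp.single 2 1 : Fin 4 →₀ ℕ).update 2
        ((Finsupp.single 0 1 + Finsupp.single 2 1 : Fin 4 →₀ ℕ) 0 + (Finsupp.single 0 1 + Finsupp.single 2 1 : Fin 4 →₀ ℕ) 2 - 2) =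
          Finsupp.single 0 1 := by
      ext i; fin_cases i <;> simp [Finsupp.update_apply]
    rw [e1, e2, if_neg (by decide), ← X_pow_mul_X_eq_monomial]
    rfl

/-- **THE CHILD'S BLOW-UP IS DEAD** (characteristic 2): `v₄ + v₃` has linear coefficient `1` of `v₄`; `v₁² v₄ + v₁` has linear coefficient
`2 b₁ b₄ + 1 = 1` of `v₁`. [cite: Hauser2010, §F (equiconstant points)] -/
theorem not_isEquimultiplePoint_G_two [DecidableEq K] {k : Fin 4} (hk : k ∈ ({0, 2} : Finset (Fin 4))) (b : Fin 4 → K)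
    (s : State K) (hs : s.F = X 0 ^ 2 * X 3 + X 0 * X 2) : ¬ CentreBlowup.IsEquimultiplePoint 2 ({0, 2} : Finset (Fin 4)) k b s := by
  intro h
  unfold CentreBlowup.IsEquimultiplePoint CentreBlowup.pointTransform at h
  rw [hs, chartTransform_G_two k hk] at h
  rcases Finset.mem_insert.mp hk with rfl | hk
  · rw [if_pos rfl] at h
    have h3 := h (Finsupp.single 3 1) (Finsupp.single_ne_zero.mpr one_ne_zero) (by rw [Finsupp.degree_single]; norm_num)
    rw [coeff_single_one_translate] at h3
    simp at h3
  · have hk' : k = 2 := Finset.mem_singleton.mp hk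
    subst hk'
    rw [if_neg (by decide)] at h
    have h0 := h (Finsupp.single 0 1) (Finsupp.single_ne_zero.mpr one_ne_zero) (by rw [Finsupp.degree_single]; norm_num)
    rw [coeff_single_one_translate] at h0
    simp [(pderiv (0 : Fin 4)).leibniz_pow] at h0
    rw [CharTwo.two_eq_zero] at h0
    simp at h0

omit [CharP K 2] in
/-- The child's state differs from the waiting kid's state. [folklore] -/
theorem G_two_ne_H_two : (X 0 ^ 2 * X 3 + X 0 * X 2 : MvPolynomial (Fin 4) K) ≠ X 0 ^ 2 * X 3 + X 0 * X 2 ^ 2 := by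
  intro h
  have hc := congrArg (coeff (Finsupp.single (0 : Fin 4) 1 + Finsupp.single 2 1)) h
  have h2 : (X 0 * X 2 ^ 2 : MvPolynomial (Fin 4) K) = monomial (Finsupp.single 0 1 + Finsupp.single 2 2) 1 := by
    rw [X_pow_eq_monomial, X, monomial_mul, mul_one]
  have n1 : (Finsupp.single (0 : Fin 4) 1 + Finsupp.single 2 1) ≠ Finsupp.single 0 2 + Finsupp.single 3 1 := fun h' => by
    have := DFunLike.congr_fun h' 0; simp at this
  have n2 : (Finsupp.single (0 : Fin 4) 1 + Finsupp.single 2 1) ≠ Finsupp.single 0 1 + Finsupp.single 2 2 := fun h' => by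
    have := DFunLike.congr_fun h' 2; simp at this
  rw [G_two_eq_monomial_add, X_pow_mul_X_eq_monomial, h2] at hc
  simp [coeff_monomial, n1.symm, n2.symm] at hc

/-! ## §2 The certificate in characteristic 2 -/

/-- **THE TOY IN CHARACTERISTIC 2, CERTIFIED**: `(𝔸⁵_K, (z² + x₁² x₄ + x₁x₂(x₃² − 1))·𝒪, [], 2)` admits a marked resolution — host
`V(z, x₁, x₂)`, then the waiting kid `V(z′, y₁, y₃ − 1)`, then its child `V(z″, u₁, u₃)` of the `y₃`-chart; nothing of order 2 survives.
[cite: BierstoneGrigorievMilmanWlodarczyk2011, Def. 3.1.3] [cite: HauserPerlega2019PRIMS, §2] [cite: Hauser2010, §F] -/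
theorem exists_isMarkedResolution_inst₁₅ [IsAlgClosed K] [DecidableEq K] :
    ∃ (X' : Scheme.{0}) (ρ : X' ⟶ P 4 K) (M' : MarkedIdeal X'),
      IsMarkedResolution (⟨hypSheaf 2
        (X 0 ^ 2 * X 3 + X 0 * X 1 ^ (2 - 1) * X 2 ^ 2 - X 0 * X 1 ^ (2 - 1) : MvPolynomial (Fin 4) K), [], 2⟩ :
        MarkedIdeal (P 4 K)) ρ M' := by
  classical
  set F : MvPolynomial (Fin 4) K := X 0 ^ 2 * X 3 + X 0 * X 1 ^ (2 - 1) * X 2 ^ 2 - X 0 * X 1 ^ (2 - 1) with hFdef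
  set s₀ : State K := ⟨F, 0, ∅⟩ with hs₀def
  have hs₀ : s₀ = ⟨deletePthPowers 2 (PointBlowup.translate (0 : Fin 4 → K) F), 0, ∅⟩ := by
    rw [PointBlowup.translate_zero,
      Literature.Barriers.ResolutionOfSingularities.HauserPerlega.deletePthPowers_eq_self (isClean_F_toy (p := 2))]
  set wt₀ : Fin 4 × (Fin 4 → K) × Finset (Fin 4) := ((1 : Fin 4), (Pi.single 2 1 : Fin 4 → K), ({0, 2} : Finset (Fin 4)))
    with hwt₀
  set e₀ : Fin 4 × (Fin 4 → K) × Finset (Fin 4) := ((2 : Fin 4), (0 : Fin 4 → K), ({0, 2} : Finset (Fin 4))) with he₀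
  set s₁ : State K := CentreBlowup.step 2 ({0, 1} : Finset (Fin 4)) 1 (Pi.single 2 1 : Fin 4 → K) s₀ with hs₁
  have hs₁F : s₁.F = X 0 ^ 2 * X 3 + X 0 * X 2 ^ 2 := by rw [hs₁, hs₀def, hFdef]; exact step_F_waiting_toy (p := 2)
  set s₂ : State K := CentreBlowup.step 2 ({0, 2} : Finset (Fin 4)) 2 (0 : Fin 4 → K) s₁ with hs₂
  have hs₂F : s₂.F = X 0 ^ 2 * X 3 + X 0 * X 2 := step_T_two_H_two s₁ hs₁F
  -- the rules below the host: one child under the waiting kid, nothing else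
  let plan : State K → Finset (Fin 4) → Finset (Fin 4 × (Fin 4 → K) × Finset (Fin 4)) := fun s _ =>
    if s.F = X 0 ^ 2 * X 3 + X 0 * X 2 ^ 2 then {e₀} else ∅
  let leaves : State K → Finset (Fin 4) → Finset (Fin 4 × (Fin 4 → K)) := fun _ _ => ∅
  have hplan₁ : plan s₁ ({0, 2} : Finset (Fin 4)) = {e₀} := if_pos hs₁F
  have hplan₂ : ∀ T, plan s₂ T = ∅ := fun T => if_neg (by rw [hs₂F]; exact G_two_ne_H_two)
  have hreach : ∀ q : State K × Finset (Fin 4),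
      Relation.ReflTransGen (fun q q' : State K × Finset (Fin 4) =>
        ∃ e ∈ plan q.1 q.2, q' = (CentreBlowup.step 2 q.2 e.1 e.2.1 q.1, e.2.2)) (s₁, ({0, 2} : Finset (Fin 4))) q →
      q = (s₁, ({0, 2} : Finset (Fin 4))) ∨ q = (s₂, ({0, 2} : Finset (Fin 4))) := by
    intro q hq
    induction hq with
    | refl => exact Or.inl rfl
    | tail _ hR ih =>
      obtain ⟨e, he, rfl⟩ := hR
      rcases ih with h | h <;> rw [h] at he ⊢
      · rw [hplan₁, Finset.mem_singleton] at he
        subst he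
        exact Or.inr rfl
      · rw [hplan₂ ({0, 2} : Finset (Fin 4))] at he
        exact absurd he (Finset.notMem_empty e)
  have hacc₂ : Acc (fun q' q : State K × Finset (Fin 4) =>
      ∃ e ∈ plan q.1 q.2, q' = (CentreBlowup.step 2 q.2 e.1 e.2.1 q.1, e.2.2)) (s₂, ({0, 2} : Finset (Fin 4))) :=
    Acc.intro _ fun q' ⟨e, he, _⟩ => by
      rw [hplan₂ ({0, 2} : Finset (Fin 4))] at he; exact absurd he (Finset.notMem_empty e)
  have hacc₁ : Acc (fun q' q : State K × Finset (Fin 4) =>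
      ∃ e ∈ plan q.1 q.2, q' = (CentreBlowup.step 2 q.2 e.1 e.2.1 q.1, e.2.2)) (s₁, ({0, 2} : Finset (Fin 4))) :=
    Acc.intro _ fun q' ⟨e, he, hq'⟩ => by
      rw [hplan₁, Finset.mem_singleton] at he
      subst he; rw [hq']; exact hacc₂
  refine exists_isMarkedResolution_joint_forest_root_waiting (p := 2) F (F_toy_ne_zero (p := 2)) (isClean_F_toy (p := 2)) plan leaves 0
    ({0, 1} : Finset (Fin 4)) s₀ hs₀ (isPermissibleCentre_F_toy (p := 2)) ∅ {wt₀} ∅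
    (fun e he => absurd he (Finset.notMem_empty e)) (fun e he => absurd he (Finset.notMem_empty e))
    (fun wt hwt => ?_) (fun wt hwt wt' hwt' hne => ?_) (fun e he => absurd he (Finset.notMem_empty e))
    (fun l hl => absurd hl (Finset.notMem_empty l)) (fun j' b' hj' hb' _ heq => ?_) (fun q hq => ?_)
    (fun e he => absurd he (Finset.notMem_empty e)) (fun wt hwt => ?_) (fun b' H => ?_)
  · -- the waiting entry is admissible
    rw [Finset.mem_singleton] at hwt
    subst hwt
    refine ⟨by simp [hwt₀], fun i hi => ?_,
      by show (({0, 1} : Finset (Fin 4)).erase 1) ⊆ ({0, 2} : Finset (Fin 4)); decide,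
      by show (1 : Fin 4) ∉ ({0, 2} : Finset (Fin 4)); decide, ?_⟩
    · simp only [Finset.mem_insert, Finset.mem_singleton] at hi
      rcases hi with rfl | rfl <;> simp [hwt₀]
    · change IsPermissibleCentre 2 ({0, 2} : Finset (Fin 4)) (PointBlowup.translate (Pi.single 2 1 : Fin 4 → K) F)
      rw [hFdef, translate_e₂_F_toy (p := 2)]
      exact isPermissibleCentre_T_F_toy (p := 2)
  · rw [Finset.mem_singleton] at hwt hwt'
    exact absurd (hwt.trans hwt'.symm) hne
  · -- three-way cover over the host
    simp only [Finset.mem_insert, Finset.mem_singleton] at hj'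
    rcases hj' with rfl | rfl
    · exact absurd heq (not_isEquimultiplePoint_pair_zero_F_toy (p := 2) b' s₀ rfl)
    · obtain ⟨hb0, hb2⟩ := cases_pair_one_F_toy (p := 2) s₀ rfl heq
      refine Or.inr (Or.inl ⟨wt₀, Finset.mem_singleton_self _, rfl, fun i hi => ?_⟩)
      change i ∈ ({0, 2} : Finset (Fin 4)) at hi
      simp only [Finset.mem_insert, Finset.mem_singleton] at hi
      rcases hi with rfl | rfl
      · rw [hb0]; simp [hwt₀]
      · rw [hb2]; simp [hwt₀]
  · -- below the waiting kid: the child, then nothing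
    rcases hq with ⟨e, he, -⟩ | ⟨wt, hwt, hq⟩
    · exact absurd he (Finset.notMem_empty e)
    rw [Finset.mem_singleton] at hwt
    subst hwt
    rcases hreach q hq with rfl | rfl
    · rw [show plan (s₁, ({0, 2} : Finset (Fin 4))).1 (s₁, ({0, 2} : Finset (Fin 4))).2 = {e₀} from hplan₁]
      refine ⟨fun e he => ?_, fun e he e' he' hne' => ?_, fun l hl => absurd hl (Finset.notMem_empty l),
        fun j'' b'' hj'' hb'' _ heq => ?_⟩
      · rw [Finset.mem_singleton] at he
        subst he
        refine ⟨by simp [he₀], rfl, Finset.Subset.refl _, isEquimultiplePoint_T_two_zero_H_two s₁ hs₁F, ?_⟩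
        change IsPermissibleCentre 2 ({0, 2} : Finset (Fin 4)) s₂.F
        rw [hs₂F]
        exact isPermissibleCentre_G_two
      · rw [Finset.mem_singleton] at he he'
        exact absurd (he.trans he'.symm) hne'
      · simp only [Finset.mem_insert, Finset.mem_singleton] at hj''
        rcases hj'' with rfl | rfl
        · exact absurd heq (not_isEquimultiplePoint_T_zero_H_toy (p := 2) b'' s₁ hs₁F)
        · have hb0 : b'' 0 = 0 := eq_zero_of_isEquimultiplePoint_T_two_H_two s₁ hs₁F heq
          refine Or.inl ⟨e₀, Finset.mem_singleton_self _, rfl, fun i hi => ?_⟩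
          change i ∈ ({0, 2} : Finset (Fin 4)) at hi
          simp only [Finset.mem_insert, Finset.mem_singleton] at hi
          rcases hi with rfl | rfl
          · rw [hb0]; rfl
          · rw [hb'']; rfl
    · rw [show plan (s₂, ({0, 2} : Finset (Fin 4))).1 (s₂, ({0, 2} : Finset (Fin 4))).2 = ∅ from hplan₂ {0, 2}]
      refine ⟨fun e he => absurd he (Finset.notMem_empty e), fun e he => absurd he (Finset.notMem_empty e),
        fun l hl => absurd hl (Finset.notMem_empty l), fun j'' b'' hj'' hb'' _ heq => ?_⟩
      exact absurd heq (not_isEquimultiplePoint_G_two hj'' b'' _ hs₂F)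
  · rw [Finset.mem_singleton] at hwt
    subst hwt
    exact hacc₁
  · -- the root cover
    obtain ⟨hb0, hb⟩ := roots_F_toy (p := 2) b' H
    rcases hb with hb1 | hb2
    · left
      intro i hi
      simp only [Finset.mem_insert, Finset.mem_singleton] at hi
      rcases hi with rfl | rfl
      · rw [hb0]; rfl
      · rw [hb1]; rfl
    · right
      refine ⟨wt₀, Finset.mem_singleton_self _, fun i hi => ?_⟩
      change i ∈ ({0, 2} : Finset (Fin 4)) at hi
      simp only [Finset.mem_insert, Finset.mem_singleton] at hi
      rcases hi with rfl | rfl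
      · rw [hb0]; simp [hwt₀]
      · rw [hb2]; simp [hwt₀]

end InstanceTwo

end Equimultiple

end Summit.ResolutionOfSingularities.ResolutionOfSingularities.Theorems.PIDim4

end
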